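import Summits.QuantumFields.QCD.Theses.PauliWegnerSea
import Literature.MathematicalPhysics.QuantumFieldTheory.QCDCurrentSector
import Literature.MathematicalPhysics.QuantumFieldTheory.QCDTimeReflection
import Summits.QuantumFields.QCD.Theorems.SpectralDefectExtinctionWindowExtinctionChessboardTransferFragments
import Summits.QuantumFields.QCD.Theorems.PauliWegnerSeaChiralOneScaleTrajectoryStubApTranslation
import Summits.QuantumFields.QCD.Theorems.PauliWegnerSeaChiralOneScaleTrajectoryStubTransferPositivity
import Summits.QuantumFields.QCD.Theorems.PauliWegnerSeaChiralOneScaleTrajectoryStubChord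
import Summits.QuantumFields.QCD.Theorems.PauliWegnerSeaChiralOneScaleTrajectoryStubPinOfLatticeLightness

/-!
# Line `log-convex-continuum-lift` — skeleton v4 (lead a3-0) for crux `PauliWegnerSea.ChiralOneScaleTrajectory`
(stmt-QuantumFields-17512)

STATUS v4 (2026-08-17, end of cycle 1): FOUR of five stubs LANDED and imported below — `stub_apTranslation` p146664,
`stub_transferPositivity` p145578 (+ Obs p144139, Gram p144434), `stub_chord` p143291, `stub_pinOfLatticeLightness` p145422
(+ Aux p144259); consolidation `isChiralAtZero_of_latticeLightness` / `chiralOneScaleTrajectory_of_lightWitness` proposed as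
`Theorems/PauliWegnerSeaChiralOneScaleTrajectoryPinOfLatticeLightness.lean` (p148425). ONE sorry remains: `stub_lightWitness`
(crux-sized: ⊇ stmt-QuantumFields-11513 verbatim) — handed back `promote-stub` (see PROMOTE.md on the item).

Card: `Cruxes/ChiralOneScaleTrajectory/Ideas/log-convex-continuum-lift.md`; planner skeleton v1:
`Cruxes/ChiralOneScaleTrajectory/Lines/log_convex_continuum_lift.lean` (3 stubs).  RESHAPED by the lead (v2, this
file) into FIVE registered stubs, all DEF-FREE (every statement is written with the local NOTATION PRELUDE below,
which expands to tree declarations only, so that every stub lands as a pure theorem file — kernel-reviewed):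

* `stub_apTranslation`    — translation invariance of the UN-normalised time-ANTIPERIODIC two-bilinear functional
  on the odd torus (moving the antiperiodic layer is the `ℤ₂` substitution `ψ ↦ σψ, ψ̄ ↦ σψ̄` on the slab between
  the two layers; equal-site bilinears and the Berezin integral are blind to it).  Generic, size M–L.
* `stub_transferPositivity` — the RP–HANKEL form of Lüscher positivity, i.e. exactly what the LANDED odd-torus
  site-reflection positivity `WilsonQCDSiteReflectionPositivityAP_holds` (un-normalised, with the universal phase
  `posConst`) gives by 2×2 Gram/Cauchy–Schwarz on positive-time smeared pseudoscalars `X_s = Σ_z h(z)(ψ̄_f γ₅ ψ_g)(s,z)`: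
  a unit complex phase `u` with (G1) `u·𝒟_h(2s) ≥ 0`, (G2) `‖𝒟_h(s+t)‖² ≤ Re(u𝒟_h(2s))·Re(u𝒟_h(2t))`
  (`1 ≤ s,t ≤ S`), (G3) axis maximality at even times `‖N(2t e₀ + w)‖ ≤ Re(u N(2t e₀))`.  EVEN separations only:
  the odd half and `Z_AP ≠ 0` of v1 (transfer-OPERATOR facts) are NOT asked — the lift runs on even times and the
  witness supplies `Z_AP ≠ 0` at its own parameters (inside `LIGHT`).  Generic, size L.
* `stub_chord` — pure real analysis: a non-negative finite sequence with `e_j² ≤ e_{j-1} e_{j+1}` obeys the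
  three-point chord inequality with `ℕ` exponents.  Size S.
* `stub_pinOfLatticeLightness` — the lift (bookkeeping + real arithmetic): TP → chord → ∀ reg, β_k ≥ 0 eventually →
  clause (i) → LogRoom → TwistInsensitive → LatticeLightness(even times, with `0 < ‖Z_AP‖`) → `reg.IsChiralAtZero`.
  Size M–L.
* `stub_lightWitness` — the light witness `C⁺` (OPEN; ⊇ stmt-QuantumFields-11513 verbatim; held by the lead).
* `ChiralOneScaleTrajectory_of` — kernel-checked composition concluding the crux BY NAME.

Proof route of the lift (all exponents in `ℕ`, all comparisons of complex numbers through `‖·‖`):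
`E_j := Re(u 𝒟_h(2j)) = ‖𝒟_h(2j)‖ ≥ 0` (G1); local log-convexity `E_j² ≤ E_{j-1}E_{j+1}` (G2 at `(j−1,j+1)`);
chord at `(n₁, n₂, t_k)`, `t_k := ⌈K |log a_k| /(2 a_k)⌉`, with lightness `E_{n₁} ≤ E_{n₂} e^{ε a_k (n₂−n₁)}` and the
floor `E_{n₂} ≥ C a_k^p (Σ|h|)² ‖Z_AP‖ > 0` gives `E_{t_k} ≥ E_{n₂} e^{−ε a_k (t_k − n₂)}`; (G3) gives
`‖N_AP(2t_k e₀)‖ ≥ E_{t_k}/(Σ|h|)²`; TwistInsensitive (`n a_k ≤ (K+2)(1+|log a_k|)`) gives `‖N_P‖ ≥ ½‖N_AP‖`,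
`0 < ‖Z_P‖ ≤ (3/2)‖Z_AP‖`; the charged pair `A = ψ̄_g γ₅ ψ_f`, `B = ψ̄_f γ₅ ψ_g` (`pseudoscalarDensityObs … (Matrix.single …)`)
has connected = full correlator (`IsFlavourCharged.qcdLatticeConnectedCorr_eq`) `= N_P(2t_k e₀)/Z_P` by
`pseudoscalarDensityObs_single_onTorus`; hence `‖corr(2t_k)‖ e^{ε a_k 2t_k} ≥ (C/3) a_k^{p − εK/2}... → ∞` for
`K := 2(p+1)/ε`, contradicting `HasLatticeMassGap ε` at `S = L_k`, `n = 2t_k ≤ L_k` (LogRoom).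

Disproof.lean (cdisprove FINAL, verdict resists; no `-- Targets`, no `stub_*_false`) honoured exactly as in v1: the pin
rides INSIDE the `∃ reg` (Negative/UpShift), superlog volume is asked (Negative/VolumeGrowth), (iii) LOWER kept verbatim.
-/

noncomputable section

namespace Summit.QuantumFields.QCD.Cruxes.ChiralOneScaleTrajectory.LogConvexLift

open scoped BigOperators Topology ComplexOrder
open MeasureTheory Filter
open Literature.MathematicalPhysics.QuantumFieldTheory Literature.MathematicalPhysics.QuantumLattice
  Literature.Probability.LatticeModels

/-! ### NOTATION PRELUDE (paste verbatim into every stub work file; expands to tree declarations only)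

* `nAP⟪β, S, mq, f, g, v⟫` — UN-normalised antiperiodic flavoured pion numerator on the torus of side `2S+1`:
  `∫dμ_W(β) ∫dψ̄dψ (ψ̄_g γ₅ ψ_f)(0) · (ψ̄_f γ₅ ψ_g)(v) · e^{−ψ̄ D_AP(U) ψ}` (`v : Site 4`, read mod `2S+1`);
* `nP⟪…⟫` — the same with the Statement's time-PERIODIC `fermiBoltzmann`;
* `zAP⟪β, S, mq⟫`, `zP⟪β, S, mq⟫` — the two partition functions;
* `dAP⟪β, S, mq, f, g, T, h, n⟫` — the source-and-sink smeared trace `𝒟_h(n) = Σ_{z,z' ∈ T} h z h z' N_AP(n e₀ + z' − z)`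
  for a real profile `h` on the finite set `T` of (spatial) sites;
* `APTI⟪Nf⟫`, `TP⟪Nf⟫`, `CHORD`, `LOGROOM⟪reg⟫`, `TWIST⟪Nf, reg⟫`, `LIGHT⟪Nf, reg⟫` — the Props of the stubs. -/

local notation "SU3" => Matrix.specialUnitaryGroup (Fin 3) ℂ

local notation "nAP⟪" β ", " S ", " mq ", " f ", " g ", " v "⟫" =>
  (∫ U : GaugeConfig 4 (2 * S + 1) (Matrix.specialUnitaryGroup (Fin 3) ℂ),
      fermiIntegral (torusBilinear g f (Torus.proj (2 * S + 1) 0) (Torus.proj (2 * S + 1) 0) gammaFive 1 *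
          torusBilinear f g (Torus.proj (2 * S + 1) v) (Torus.proj (2 * S + 1) v) gammaFive 1 *
        fermiBoltzmannAP U mq)
    ∂(wilsonMeasure (fundamentalRep (Fin 3)) β))

local notation "nP⟪" β ", " S ", " mq ", " f ", " g ", " v "⟫" =>
  (∫ U : GaugeConfig 4 (2 * S + 1) (Matrix.specialUnitaryGroup (Fin 3) ℂ),
      fermiIntegral (torusBilinear g f (Torus.proj (2 * S + 1) 0) (Torus.proj (2 * S + 1) 0) gammaFive 1 *
          torusBilinear f g (Torus.proj (2 * S + 1) v) (Torus.proj (2 * S + 1) v) gammaFive 1 *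
        fermiBoltzmann U mq)
    ∂(wilsonMeasure (fundamentalRep (Fin 3)) β))

local notation "zAP⟪" β ", " S ", " mq "⟫" =>
  (∫ U : GaugeConfig 4 (2 * S + 1) (Matrix.specialUnitaryGroup (Fin 3) ℂ),
      fermiIntegral (fermiBoltzmannAP U mq) ∂(wilsonMeasure (fundamentalRep (Fin 3)) β))

local notation "zP⟪" β ", " S ", " mq "⟫" =>
  (∫ U : GaugeConfig 4 (2 * S + 1) (Matrix.specialUnitaryGroup (Fin 3) ℂ),
      fermiIntegral (fermiBoltzmann U mq) ∂(wilsonMeasure (fundamentalRep (Fin 3)) β))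

local notation "dAP⟪" β ", " S ", " mq ", " f ", " g ", " T ", " h ", " n "⟫" =>
  (∑ z ∈ (T : Finset (Literature.Probability.LatticeModels.Site 4)),
    ∑ z' ∈ (T : Finset (Literature.Probability.LatticeModels.Site 4)),
      (((h : Literature.Probability.LatticeModels.Site 4 → ℝ) z * h z' : ℝ) : ℂ) *
        nAP⟪β, S, mq, f, g, (Pi.single (0 : Fin 4) (((n : ℕ) : ℤ)) + (z' - z))⟫)

-- `APTI⟪Nf⟫`: translation invariance of the un-normalised antiperiodic two-bilinear functional.
set_option quotPrecheck false in
local notation "APTI⟪" Nf "⟫" =>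
  (∀ (β : ℝ) (S : ℕ) (mq : Fin Nf → ℝ) (f g f' g' : Fin Nf) (Γ Γ' : Matrix (Fin 4) (Fin 4) ℂ)
      (x y u : TorusSite 4 (2 * S + 1)),
    (∫ U : GaugeConfig 4 (2 * S + 1) (Matrix.specialUnitaryGroup (Fin 3) ℂ),
        fermiIntegral (torusBilinear f g x x Γ 1 * torusBilinear f' g' y y Γ' 1 * fermiBoltzmannAP U mq)
      ∂(wilsonMeasure (fundamentalRep (Fin 3)) β)) =
    ∫ U : GaugeConfig 4 (2 * S + 1) (Matrix.specialUnitaryGroup (Fin 3) ℂ),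
        fermiIntegral (torusBilinear f g (x + u) (x + u) Γ 1 * torusBilinear f' g' (y + u) (y + u) Γ' 1 *
          fermiBoltzmannAP U mq)
      ∂(wilsonMeasure (fundamentalRep (Fin 3)) β))

-- `TP⟪Nf⟫`: the RP–Hankel form of transfer positivity (even separations, phase `u`).
set_option quotPrecheck false in
local notation "TP⟪" Nf "⟫" =>
  (∀ (β : ℝ), 0 ≤ β → ∀ (S : ℕ), 1 ≤ S → ∀ (mq : Fin Nf → ℝ), (∀ fl, -1 < mq fl) → ∀ (f g : Fin Nf),
    ∃ u : ℂ, ‖u‖ = 1 ∧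
      (∀ (T : Finset (Literature.Probability.LatticeModels.Site 4)) (h : Literature.Probability.LatticeModels.Site 4 → ℝ),
        (∀ z ∈ T, z 0 = 0 ∧ ∀ i, |z i| ≤ (S : ℤ)) →
        ∀ (s t : ℕ), 1 ≤ s → s ≤ S → 1 ≤ t → t ≤ S →
          0 ≤ u * dAP⟪β, S, mq, f, g, T, h, 2 * s⟫ ∧
          ‖dAP⟪β, S, mq, f, g, T, h, s + t⟫‖ ^ 2 ≤
            (u * dAP⟪β, S, mq, f, g, T, h, 2 * s⟫).re * (u * dAP⟪β, S, mq, f, g, T, h, 2 * t⟫).re) ∧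
      (∀ (t : ℕ) (w : Literature.Probability.LatticeModels.Site 4), 1 ≤ t → t ≤ S → w 0 = 0 →
        (∀ i, |w i| ≤ (S : ℤ)) →
          ‖nAP⟪β, S, mq, f, g, (Pi.single (0 : Fin 4) (((2 * t : ℕ) : ℤ)) + w)⟫‖ ≤
            (u * nAP⟪β, S, mq, f, g, (Pi.single (0 : Fin 4) (((2 * t : ℕ) : ℤ)))⟫).re))

-- `CHORD`: local log-convexity of a non-negative finite sequence gives the three-point chord inequality.
set_option quotPrecheck false in
local notation "CHORD" =>
  (∀ (e : ℕ → ℝ) (N : ℕ), (∀ j, 1 ≤ j → j ≤ N → 0 ≤ e j) →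
    (∀ j, 2 ≤ j → j + 1 ≤ N → e j ^ 2 ≤ e (j - 1) * e (j + 1)) →
    ∀ i j k : ℕ, 1 ≤ i → i < j → j < k → k ≤ N → e j ^ (k - i) ≤ e i ^ (k - j) * e k ^ (j - i))

-- `LOGROOM⟪reg⟫`: superlogarithmic physical volume.
set_option quotPrecheck false in
local notation "LOGROOM⟪" reg "⟫" =>
  (Tendsto (fun k => QCDRegularisation.a reg k * (QCDRegularisation.L reg k : ℝ) /
    (1 + |Real.log (QCDRegularisation.a reg k)|)) atTop atTop)

-- `TWIST⟪Nf, reg⟫`: the `(−1)^F` twist is invisible at log-scale separations, at `S = L_k`, eventually.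
set_option quotPrecheck false in
local notation "TWIST⟪" Nf ", " reg "⟫" =>
  (∀ (m : Fin Nf → ℝ), (∀ fl, 0 < m fl) → ∀ (f g : Fin Nf), f ≠ g → ∀ K : ℝ, ∀ᶠ k in atTop,
    2 * ‖zAP⟪QCDRegularisation.β reg k, QCDRegularisation.L reg k,
            fun fl => QCDRegularisation.mcrit reg k + QCDRegularisation.a reg k * m fl / QCDRegularisation.Zm reg k⟫ -
          zP⟪QCDRegularisation.β reg k, QCDRegularisation.L reg k,
            fun fl => QCDRegularisation.mcrit reg k + QCDRegularisation.a reg k * m fl / QCDRegularisation.Zm reg k⟫‖ ≤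
      ‖zAP⟪QCDRegularisation.β reg k, QCDRegularisation.L reg k,
          fun fl => QCDRegularisation.mcrit reg k + QCDRegularisation.a reg k * m fl / QCDRegularisation.Zm reg k⟫‖ ∧
    ∀ n : ℕ, (n : ℝ) * QCDRegularisation.a reg k ≤ K * (1 + |Real.log (QCDRegularisation.a reg k)|) →
      2 * ‖nAP⟪QCDRegularisation.β reg k, QCDRegularisation.L reg k,
              fun fl => QCDRegularisation.mcrit reg k + QCDRegularisation.a reg k * m fl / QCDRegularisation.Zm reg k,
              f, g, (Pi.single (0 : Fin 4) ((n : ℕ) : ℤ))⟫ -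
            nP⟪QCDRegularisation.β reg k, QCDRegularisation.L reg k,
              fun fl => QCDRegularisation.mcrit reg k + QCDRegularisation.a reg k * m fl / QCDRegularisation.Zm reg k,
              f, g, (Pi.single (0 : Fin 4) ((n : ℕ) : ℤ))⟫‖ ≤
        ‖nAP⟪QCDRegularisation.β reg k, QCDRegularisation.L reg k,
            fun fl => QCDRegularisation.mcrit reg k + QCDRegularisation.a reg k * m fl / QCDRegularisation.Zm reg k,
            f, g, (Pi.single (0 : Fin 4) ((n : ℕ) : ℤ))⟫‖)

-- `LIGHT⟪Nf, reg⟫`: LatticeLightness at EVEN lattice times `2n₁ < 2n₂` within a fixed physical distance, with a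
-- polynomial floor relative to `‖Z_AP‖ > 0`, frequently in `k`, at `S = L_k`.
set_option quotPrecheck false in
local notation "LIGHT⟪" Nf ", " reg "⟫" =>
  (∀ ε : ℝ, 0 < ε → ∃ m : Fin Nf → ℝ, (∀ fl, 0 < m fl) ∧ ∃ (f g : Fin Nf), f ≠ g ∧
    ∃ (R : ℝ) (p : ℕ) (C : ℝ), 0 < C ∧ ∃ᶠ k in atTop,
      ∃ (T : Finset (Literature.Probability.LatticeModels.Site 4)) (h : Literature.Probability.LatticeModels.Site 4 → ℝ)
        (n₁ n₂ : ℕ),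
        1 ≤ n₁ ∧ n₁ < n₂ ∧ (n₂ : ℝ) * QCDRegularisation.a reg k ≤ R ∧
        (∀ z ∈ T, z 0 = 0 ∧ ∀ i, |z i| ≤ (n₂ : ℤ)) ∧
        0 < ∑ z ∈ T, |h z| ∧
        0 < ‖zAP⟪QCDRegularisation.β reg k, QCDRegularisation.L reg k,
              fun fl => QCDRegularisation.mcrit reg k + QCDRegularisation.a reg k * m fl / QCDRegularisation.Zm reg k⟫‖ ∧
        C * QCDRegularisation.a reg k ^ p * ((∑ z ∈ T, |h z|) ^ 2 *
            ‖zAP⟪QCDRegularisation.β reg k, QCDRegularisation.L reg k,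
              fun fl => QCDRegularisation.mcrit reg k + QCDRegularisation.a reg k * m fl / QCDRegularisation.Zm reg k⟫‖) ≤
          ‖dAP⟪QCDRegularisation.β reg k, QCDRegularisation.L reg k,
              fun fl => QCDRegularisation.mcrit reg k + QCDRegularisation.a reg k * m fl / QCDRegularisation.Zm reg k,
              f, g, T, h, 2 * n₂⟫‖ ∧
        ‖dAP⟪QCDRegularisation.β reg k, QCDRegularisation.L reg k,
            fun fl => QCDRegularisation.mcrit reg k + QCDRegularisation.a reg k * m fl / QCDRegularisation.Zm reg k,
            f, g, T, h, 2 * n₁⟫‖ ≤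
          ‖dAP⟪QCDRegularisation.β reg k, QCDRegularisation.L reg k,
              fun fl => QCDRegularisation.mcrit reg k + QCDRegularisation.a reg k * m fl / QCDRegularisation.Zm reg k,
              f, g, T, h, 2 * n₂⟫‖ * Real.exp (ε * (QCDRegularisation.a reg k * ((n₂ : ℝ) - n₁))))

/-! ### Registered stubs -/

/-- **Stub 1 · translation invariance of the un-normalised antiperiodic two-bilinear functional** on the odd
torus `2S+1` (every `β`, all masses, all flavours and spin matrices): translating both equal-site bilinears by
`u` does not change `∫dμ_W ∫dψ̄dψ (ψ̄_f Γ ψ_g)(x) (ψ̄_{f'} Γ' ψ_{g'})(y) e^{−ψ̄ D_AP(U) ψ}`.  Spatial part: the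
tree's `quarkTranslate` / `wilsonMeasure_map_torusConfigShift` / `fermiIntegral_quarkTranslate`; temporal part:
the antiperiodic layer moved by `−u₀` differs from the original by the `ℤ₂` gauge `σ` of the slab between the two
layers (`D_AP' = σ D_AP σ`), and `ψ ↦ σψ, ψ̄ ↦ σψ̄` fixes equal-site bilinears and the Berezin integral. -/
theorem stub_apTranslation : ∀ Nf : ℕ, APTI⟪Nf⟫ :=
  -- LANDED p146664: Theorems/PauliWegnerSeaChiralOneScaleTrajectoryStubApTranslation.lean
  APTranslation.stub_apTranslation

/-- **Stub 2 · transfer positivity, RP–Hankel form** (from the LANDED `WilsonQCDSiteReflectionPositivityAP_holds`,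
un-normalised version `posConst_mul_conj_integral_nonneg` with the universal phase `posConst`, applied to the
two-dimensional spans of positive-time smeared pseudoscalars `X_s = Σ_{z∈T} h(z) (ψ̄_f γ₅ ψ_g)(s e₀ + z)`,
`1 ≤ s ≤ S`, box radius `S`; the Gram matrix is `η·𝒟_h(s+t)` after Stub 1, `η` the phase of `Θ(ψ̄_f γ₅ ψ_g)`). -/
theorem stub_transferPositivity : ∀ Nf : ℕ, APTI⟪Nf⟫ → TP⟪Nf⟫ :=
  -- LANDED p145578 (+ helpers p144139 Obs, p144434 Gram): Theorems/PauliWegnerSeaChiralOneScaleTrajectoryStubTransferPositivity.lean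
  TransferPositivity.stub_transferPositivity

/-- **Stub 3 · the chord inequality** for locally log-convex non-negative finite sequences (zeros propagate). -/
theorem stub_chord : CHORD :=
  -- LANDED p143291: Theorems/PauliWegnerSeaChiralOneScaleTrajectoryStubChord.lean
  Chord.stub_chord

/-- **Stub 4 · the lift** (pure lattice bookkeeping + real arithmetic; proof route in the module docstring). -/
theorem stub_pinOfLatticeLightness : ∀ Nf : ℕ, TP⟪Nf⟫ → CHORD →
    ∀ reg : QCDRegularisation Nf, (∀ᶠ k in atTop, 0 ≤ reg.β k) →
      (∀ m : Fin Nf → ℝ, (∀ f, 0 < m f) → ∀ f : Fin Nf, ∀ᶠ k in atTop, -1 < reg.mcrit k + reg.a k * m f / reg.Zm k) →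
      LOGROOM⟪reg⟫ → TWIST⟪Nf, reg⟫ → LIGHT⟪Nf, reg⟫ → reg.IsChiralAtZero :=
  -- LANDED p145422 (+ aux p144259): Theorems/PauliWegnerSeaChiralOneScaleTrajectoryStubPinOfLatticeLightness.lean
  Lift.stub_pinOfLatticeLightness

/-- **Stub 5 · the light witness `C⁺`** (OPEN; contains stmt-QuantumFields-11513 `OneScaleTrajectory` restricted to
one `N_f` VERBATIM — held by the lead, never sub-decomposed inside this line): ONE mass-independent AF regularisation
with both scalings, the four package clauses of the crux verbatim for every positive mass tuple, superlogarithmic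
volume, twist-insensitivity at log-scale separations and lattice lightness at two fixed physical distances (even
lattice times, floor relative to `‖Z_AP‖ > 0`). -/
theorem stub_lightWitness : ∀ Nf : ℕ, Nf = 2 ∨ Nf = 3 →
    ∃ reg : QCDRegularisation Nf, reg.HasMassScaling ∧ (reg.scheme 0 0 0).HasAsymptoticScaling ∧
    (∀ m : Fin Nf → ℝ, (∀ f, 0 < m f) → (∀ f : Fin Nf, ∀ᶠ k in atTop, -1 < reg.mcrit k + reg.a k * m f / reg.Zm k) ∧ (∀ q : ℕ, ∃ K₀ s : ℝ, 0 < s ∧ s < 1 ∧ ∀ᶠ k in atTop, ∃ ℓ₀ : ℕ, 1 ≤ ℓ₀ ∧ ℓ₀ ≤ reg.L k ∧ (ℓ₀ : ℝ) * reg.a k ≤ K₀ * (1 + |Real.log (reg.a k)|) ∧ ∀ S : ℕ, reg.L k ≤ S → ∀ (f : Fin Nf) (v : Literature.Probability.LatticeModels.Site 4), v ∈ box 4 S → ‖v‖ = (ℓ₀ : ℝ) → (ℓ₀ : ℝ) ^ q * (1 + |reg.β k|) ^ q * ((∫ U : GaugeConfig 4 (2 * S + 1) (Matrix.specialUnitaryGroup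 (Fin 3) ℂ), ‖(diracMatrix U fun fl => reg.mcrit k + reg.a k * m fl / reg.Zm k).det‖ * (∑ a : Fin 3, ∑ i : Fin 4, ∑ b : Fin 3, ∑ j : Fin 4, ‖(diracMatrix U fun fl => reg.mcrit k + reg.a k * m fl / reg.Zm k)⁻¹ (quarkEquiv (f, (Torus.proj (2 * S + 1) 0, a, i))) (quarkEquiv (f, (Torus.proj (2 * S + 1) (v), b, j)))‖) ^ s ∂(wilsonMeasure (fundamentalRep (Fin 3)) (reg.β k))) / (∫ U : GaugeConfig 4 (2 * S + 1) (Matrix.specialUnitaryGroup (Fin 3) ℂ), ‖(diracMatrix U fun fl => reg.mcrit k + reg.a k * m fl / reg.Zm k).det‖ ∂(wilsonMeasure (fundamentalRep (Fin 3)) (reg.β k)))) ≤ 1) ∧ (∃ s c₀ C₁ p : ℝ, 0 < s ∧ s < 1 ∧ 0 < c₀ ∧ ∀ᶠ k in atTop, ∀ S : ℕ, reg.L k ≤ S → ∀ (f : Fin Nf) (n : ℕ), n ≤ S → c₀ * Real.exp (-(C₁ * (reg.a k * n) + p * Real.log (n + 1))) ≤ (∫ U : GaugeConfig 4 (2 *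 S + 1) (Matrix.specialUnitaryGroup (Fin 3) ℂ), ‖(diracMatrix U fun fl => reg.mcrit k + reg.a k * m fl / reg.Zm k).det‖ * (∑ a : Fin 3, ∑ i : Fin 4, ∑ b : Fin 3, ∑ j : Fin 4, ‖(diracMatrix U fun fl => reg.mcrit k + reg.a k * m fl / reg.Zm k)⁻¹ (quarkEquiv (f, (Torus.proj (2 * S + 1) 0, a, i))) (quarkEquiv (f, (Torus.proj (2 * S + 1) (Pi.single 0 (n : ℤ)), b, j)))‖) ^ s ∂(wilsonMeasure (fundamentalRep (Fin 3)) (reg.β k))) / (∫ U : GaugeConfig 4 (2 * S + 1) (Matrix.specialUnitaryGroup (Fin 3) ℂ), ‖(diracMatrix U fun fl => reg.mcrit k + reg.a k * m fl / reg.Zm k).det‖ ∂(wilsonMeasure (fundamentalRep (Fin 3)) (reg.β k)))) ∧ (∀ᶠ k in atTop, (1 / 2 : ℝ) ≤ ‖∫ U : GaugeConfig 4 (2 * reg.L k + 1) (Matrix.specialUnitaryGroup (Fin 3) ℂ), (diracMatrix U fun fl => reg.mcrit k + reg.a k * m fl / reg.Zm k).det ∂(wilsonMeasure (fundamentalRep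 (Fin 3)) (reg.β k))‖ / (∫ U : GaugeConfig 4 (2 * reg.L k + 1) (Matrix.specialUnitaryGroup (Fin 3) ℂ), ‖(diracMatrix U fun fl => reg.mcrit k + reg.a k * m fl / reg.Zm k).det‖ ∂(wilsonMeasure (fundamentalRep (Fin 3)) (reg.β k))))) ∧
    LOGROOM⟪reg⟫ ∧ TWIST⟪Nf, reg⟫ ∧ LIGHT⟪Nf, reg⟫ := by
  sorry

/-! ### Composition -/

/-- **The crux BY NAME from the five stubs.** -/
theorem ChiralOneScaleTrajectory_of :
    Summit.QuantumFields.QCD.Theses.PauliWegnerSea.ChiralOneScaleTrajectory := by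
  intro Nf hNf
  have h16 : Nf ≤ 16 := by rcases hNf with rfl | rfl <;> norm_num
  obtain ⟨reg, hMS, hAS, hpkg, hroom, htwist, hlight⟩ := stub_lightWitness Nf hNf
  have hβ : ∀ᶠ k in atTop, 0 ≤ reg.β k :=
    (Summit.QuantumFields.QCD.Cruxes.WindowExtinction.ChessboardColdCells.tendsto_beta_atTop_of_hasAsymptoticScaling
      h16 reg hAS).eventually_ge_atTop 0
  exact ⟨reg, hMS, stub_pinOfLatticeLightness Nf (stub_transferPositivity Nf (stub_apTranslation Nf)) stub_chord reg hβ
    (fun m hm => (hpkg m hm).1) hroom htwist hlight, hAS, hpkg⟩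

end Summit.QuantumFields.QCD.Cruxes.ChiralOneScaleTrajectory.LogConvexLift

end
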